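import Literature.Barriers.CriticalPhenomena.PlaquetteWalkHoleRootNoVerticalEnd
import Literature.Barriers.CriticalPhenomena.PlaquetteWalkColumnRuns
import HarnessLib

/-!
# Barrier catalogue (SAWScalingLimit): the MIDDLE isolated turn of a cost-`5` wound class-`B2a` walk lies in an EXTREME column
(«MIDDLE TURN COLUMN»)

`Z → ∞` limit model of the printed Yang–Baxter weights [GlazmanManolescu2019, §1, eq. (1)]; the «RECTANGLE COEFFICIENT» line. By
`PlaquetteWalkHoleRootNoVerticalEnd` a cost-`5` wound class-`B2a` walk from the hole root ends on a slanted side, so its isolated turns are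
the two ends of the top run, the two ends of the bottom run and exactly ONE turn `τ*` strictly between the extreme rows
(`turn_profile_of_cost_five`). This file proves that `τ*` lies in the leftmost or in the rightmost column of the walk (DESIGN-next
b-engine-1 g24 §2ter «FRAME REMARK»; exact census kit j276221: `τ*` is the observed rhombus of the classes 'ao'/'ac', in the rightmost
column, or the east end of the initial run for 'as').

The engine is ★★ `ΩG.extreme_column_segment` — THE SEGMENT LEMMA: if the isolated turns of an extreme column (no arc uses its outer side,
singly visited) lie in the extreme rows, then the column is visited in ONE straight segment of consecutive arcs `s, …, e` from one frame corner
to the other, entered through the inner side by a turn at `s` and left through the inner side by a turn at `e` — the walk does not end inside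
it (`ΩG.segment_not_last`) and never returns to it. With both columns such segments the four corners are the ends of the top and bottom runs,
and the four runs would close a cycle in the arc order (as in `PlaquetteWalkHoleRootNoVerticalEnd`). Hence:

* ★★★ `ΩG.middle_turn_in_extreme_column`: for a wound class-`B2a` walk of limit cost `5` from the hole root, every isolated-turn plaquette
  strictly between the extreme rows lies in the leftmost column (`≤ w.1 − 2`) or in the rightmost column (`≥ w.1`).

Use (venture lane «pcv-sawmu», b-engine-1 g25): second structural step toward (R2) «no doubly visited plaquette at cost 5» of
`PlaquetteWalkHoleRootRowLaw`. [GlazmanManolescu2019 §1 Fig. 1, eq. (1), Lemma 2.1, Remark 2.2; Glazman 2015 Lemma 3.1 (proof, pp. 6–7)]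
-/

noncomputable section

namespace Literature.Probability.RandomPlanarGeometry.SAW.YangBaxter

open Real
open Literature.Barriers.CriticalPhenomena.PlaquetteWalk

open private fc_fh fc_ne fh_add_Mv three_le_Mv from Literature.Probability.RandomPlanarGeometry.YangBaxterSAWGeneralDomain

namespace ΩG

variable {D : Set Face} {w r : Face} {ω : ΩG D (w.side .W) r}

/-- **THE RAW SEGMENT OF A COLUMN**: from the first arc `s` in column `X₀`, leaving vertically, the walk stays in column `X₀` for the
consecutive arcs `s, …, e` (with `e` maximal), keeps its vertical direction, and climbs or descends one row per arc.
[cite: GlazmanManolescu2019, §1, Fig. 1 (consecutive arcs lie in adjacent rhombi)] -/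
theorem column_segment_raw {X₀ : ℤ} {s : ℕ} (hs : s < ω.2.arcs.length) (hcol : (ω.2.fc s).1 = X₀)
    (hout : ω.2.sOut s = .N ∨ ω.2.sOut s = .S) :
    ∃ e, s ≤ e ∧ e < ω.2.arcs.length ∧ (e + 1 = ω.2.arcs.length ∨ (ω.2.fc (e + 1)).1 ≠ X₀) ∧
      (∀ m, s ≤ m → m ≤ e → (ω.2.fc m).1 = X₀) ∧
      ((ω.2.sOut s = .N ∧ (∀ k, s ≤ k → k < e → ω.2.sOut k = .N) ∧ ∀ k, s + k ≤ e → ω.2.fc (s + k) = (X₀, (ω.2.fc s).2 + k)) ∨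
        (ω.2.sOut s = .S ∧ (∀ k, s ≤ k → k < e → ω.2.sOut k = .S) ∧ ∀ k, s + k ≤ e → ω.2.fc (s + k) = (X₀, (ω.2.fc s).2 - k))) := by
  classical
  have hex : ∃ e, s ≤ e ∧ e < ω.2.arcs.length ∧ (e + 1 = ω.2.arcs.length ∨ (ω.2.fc (e + 1)).1 ≠ X₀) :=
    ⟨ω.2.arcs.length - 1, by omega, by omega, Or.inl (by omega)⟩
  obtain ⟨hse, he, hend⟩ := Nat.find_spec hex
  set e := Nat.find hex with he_def
  have hmin : ∀ m, s ≤ m → m < e → (ω.2.fc (m + 1)).1 = X₀ := by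
    intro m h1 h2
    by_contra hne
    exact Nat.find_min hex h2 ⟨h1, by omega, Or.inr hne⟩
  have hseg : ∀ m, s ≤ m → m ≤ e → (ω.2.fc m).1 = X₀ := by
    intro m h1 h2
    rcases Nat.eq_or_lt_of_le h1 with rfl | hlt
    · exact hcol
    · have := hmin (m - 1) (by omega) (by omega); rwa [show m - 1 + 1 = m by omega] at this
  have hcolrel : ∀ k, s ≤ k → k ≤ e → (ω.2.fc k).1 = (ω.2.fc s).1 := fun k h1 h2 => by rw [hseg k h1 h2, hcol]
  refine ⟨e, hse, he, hend, hseg, ?_⟩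
  rcases hout with hN | hS
  · left
    refine ⟨hN, fun k h1 h2 => ?_, fun k hk => ?_⟩
    · exact (ω.2.run_N hN (e - s) (by omega) (fun k' h1' h2' => hcolrel k' h1' (by omega))).1 k h1 (by omega)
    · obtain ⟨-, hrow⟩ := ω.2.run_N hN k (by omega) (fun k' h1' h2' => hcolrel k' h1' (by omega))
      exact Prod.ext (hseg _ (by omega) hk) hrow
  · right
    refine ⟨hS, fun k h1 h2 => ?_, fun k hk => ?_⟩
    · exact (ω.2.run_S hS (e - s) (by omega) (fun k' h1' h2' => hcolrel k' h1' (by omega))).1 k h1 (by omega)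
    · obtain ⟨-, hrow⟩ := ω.2.run_S hS k (by omega) (fun k' h1' h2' => hcolrel k' h1' (by omega))
      refine Prod.ext (hseg _ (by omega) hk) ?_
      simp only; omega

/-- **A CLASS-`B2a` WALK WITH A SLANTED END DOES NOT END INSIDE THE FIRST SEGMENT OF A COLUMN**: if the arcs `s, …, e` form the raw
segment of column `X₀` started at its first arc `s`, then `e` is not the last arc — otherwise the walk would return onto `r` from the
plaquette `fc e` vertically, but `r = fc firstHitG` is a visited plaquette of column `X₀`, hence inside the segment, while the segment
is monotone in the row and leaves `r` beyond its end. [cite: Glazman2015WeightedSAW, Lemma 3.1 (proof, pp. 6–7: the walk returns to `∂r`)]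
[cite: GlazmanManolescu2019, Lemma 2.1] -/
theorem segment_not_last (hr : RootedFace D (w.side .W) r) (h : ω.IsB2a) (hz : ω.1 = .N ∨ ω.1 = .S) {X₀ : ℤ} {s e : ℕ}
    (he : e < ω.2.arcs.length) (hse : s ≤ e) (hfirst : ∀ j < s, (ω.2.fc j).1 ≠ X₀)
    (hseg : ∀ m, s ≤ m → m ≤ e → (ω.2.fc m).1 = X₀)
    (hmono : (ω.2.sOut s = .N ∧ (∀ k, s ≤ k → k < e → ω.2.sOut k = .N) ∧ ∀ k, s + k ≤ e → ω.2.fc (s + k) = (X₀, (ω.2.fc s).2 + k)) ∨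
      (ω.2.sOut s = .S ∧ (∀ k, s ≤ k → k < e → ω.2.sOut k = .S) ∧ ∀ k, s + k ≤ e → ω.2.fc (s + k) = (X₀, (ω.2.fc s).2 - k))) :
    e + 1 ≠ ω.2.arcs.length := by
  intro hend
  obtain ⟨hfcr, -, -⟩ := fc_fh ω hr h
  have hfh := ω.fh_lt h
  obtain ⟨-, houte⟩ := ω.2.side_sIn_eq_nth he
  rw [hend, ω.2.nth_length] at houte
  -- `r` is vertically adjacent to `fc e`, beyond it in the direction `sOut e ∈ {N, S}`
  have hrz : r.1 = (ω.2.fc e).1 ∧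
      ((r.2 = (ω.2.fc e).2 + 1 ∧ ω.2.sOut e = .N) ∨ (r.2 + 1 = (ω.2.fc e).2 ∧ ω.2.sOut e = .S)) := by
    -- the last arc is not drawn in `r` (class `B2a`)
    have hne : ω.2.fc e ≠ r :=
      fc_ne ω hr h (by have h3 := three_le_Mv hr h; have h4 := fh_add_Mv h; unfold ΩG.Mv at h3 h4; omega) he
    have key : ∀ u, ω.1 = u → (u = .N ∨ u = .S) → (ω.2.fc e).side (ω.2.sOut e) = r.side u →
        r.1 = (ω.2.fc e).1 ∧ ((r.2 = (ω.2.fc e).2 + 1 ∧ ω.2.sOut e = .N) ∨ (r.2 + 1 = (ω.2.fc e).2 ∧ ω.2.sOut e = .S)) := by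
      intro u _ hNS hside
      rcases hfc : ω.2.fc e with ⟨x, y⟩
      rw [hfc] at hside hne
      simp only
      rcases hNS with rfl | rfl
      · -- `z = r.side N`: the last arc lies ABOVE `r` and leaves through `S`
        have e1 : Face.side (x, y) (ω.2.sOut e) = .slant r.1 (r.2 + 1) := by rw [hside]; rfl
        rcases eq_of_side_eq_slant e1 with ⟨h2, hsd⟩ | ⟨h2, hsd⟩
        · simp only [Prod.mk.injEq] at h2; exact ⟨h2.1.symm, Or.inr ⟨by omega, hsd⟩⟩
        · exfalso; apply hne; rw [h2]; obtain ⟨r1, r2⟩ := r; simp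
      · -- `z = r.side S`: the last arc lies BELOW `r` and leaves through `N`
        have e1 : Face.side (x, y) (ω.2.sOut e) = .slant r.1 r.2 := by rw [hside]; rfl
        rcases eq_of_side_eq_slant e1 with ⟨h2, hsd⟩ | ⟨h2, hsd⟩
        · exfalso; apply hne; rw [h2]
        · simp only [Prod.mk.injEq] at h2; exact ⟨h2.1.symm, Or.inl ⟨by omega, hsd⟩⟩
    exact key ω.1 rfl hz houte
  obtain ⟨hr1, hr2⟩ := hrz
  -- `firstHitG` lies in the segment
  have hrcol : (ω.2.fc ω.2.firstHitG).1 = X₀ := by rw [hfcr, hr1, hseg e hse le_rfl]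
  have hfhs : s ≤ ω.2.firstHitG := by by_contra hlt; exact hfirst _ (by omega) hrcol
  have hfhe : ω.2.firstHitG ≤ e := by omega
  -- for `e > s` the entry side of `e` is the opposite of the direction
  rcases hmono with ⟨hNs, hallN, hfcN⟩ | ⟨hSs, hallS, hfcS⟩
  · have e1 := hfcN (ω.2.firstHitG - s) (by omega)
    rw [show s + (ω.2.firstHitG - s) = ω.2.firstHitG by omega, hfcr] at e1
    have e2 := hfcN (e - s) (by omega)
    rw [show s + (e - s) = e by omega] at e2
    rcases hr2 with ⟨hr2, -⟩ | ⟨hr2, hSe⟩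
    · have e1' := congrArg Prod.snd e1; have e2' := congrArg Prod.snd e2; simp only at e1' e2'; omega
    · -- heading north but leaving through `S`: impossible
      rcases Nat.eq_or_lt_of_le hse with hes | hlt
      · rw [← hes, hNs] at hSe; exact absurd hSe (by decide)
      · -- `sIn e = S` (the predecessor is below), so `sOut e ≠ S`
        have hprev := hfcN (e - 1 - s) (by omega)
        rw [show s + (e - 1 - s) = e - 1 by omega] at hprev
        have hSN := ω.2.sIn_SN_of_col_eq (show e - 1 + 1 < ω.2.arcs.length by omega)
          (by rw [show e - 1 + 1 = e by omega, e2, hprev])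
        rw [show e - 1 + 1 = e by omega] at hSN
        rcases hSN with hSi | hNi
        · exact absurd hSe (by rw [← hSi]; exact (ω.2.sIn_ne_sOut he).symm)
        · have := ω.2.fc_pred_eq_of_sIn_N he (by omega) hNi
          rw [hprev, e2] at this; simp only [Prod.mk.injEq] at this; omega
  · have e1 := hfcS (ω.2.firstHitG - s) (by omega)
    rw [show s + (ω.2.firstHitG - s) = ω.2.firstHitG by omega, hfcr] at e1
    have e2 := hfcS (e - s) (by omega)
    rw [show s + (e - s) = e by omega] at e2
    rcases hr2 with ⟨hr2, hNe⟩ | ⟨hr2, -⟩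
    · rcases Nat.eq_or_lt_of_le hse with hes | hlt
      · rw [← hes, hSs] at hNe; exact absurd hNe (by decide)
      · have hprev := hfcS (e - 1 - s) (by omega)
        rw [show s + (e - 1 - s) = e - 1 by omega] at hprev
        have hSN := ω.2.sIn_SN_of_col_eq (show e - 1 + 1 < ω.2.arcs.length by omega)
          (by rw [show e - 1 + 1 = e by omega, e2, hprev])
        rw [show e - 1 + 1 = e by omega] at hSN
        rcases hSN with hSi | hNi
        · have := ω.2.fc_pred_eq_of_sIn_S he (by omega) hSi
          rw [hprev, e2] at this; simp only [Prod.mk.injEq] at this; omega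
        · exact absurd hNe (by rw [← hNi]; exact (ω.2.sIn_ne_sOut he).symm)
    · have e1' := congrArg Prod.snd e1; have e2' := congrArg Prod.snd e2; simp only at e1' e2'; omega

/-- ★★ **THE SEGMENT LEMMA FOR AN EXTREME COLUMN.** Let `ω` be a class-`B2a` walk from the hole root returning to a slanted side of `r`; let
`X₀` be a column no arc of which uses the side `σ ∈ {W, E}`, singly visited, whose first arc `s` leaves vertically, and suppose every turning
arc of column `X₀` lies in row `Y` or row `Y'` (all arcs in rows `[Y', Y]`). Then the arcs of column `X₀` are exactly a segment
`s, …, e` with `s < e`, `e + 1 < n`; the arc `e` leaves through the side opposite to `σ` after a vertical entry; and the segment climbs from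
`(X₀, Y')` to `(X₀, Y)` or descends from `(X₀, Y)` to `(X₀, Y')`, one row per arc.
[cite: GlazmanManolescu2019, §1, Fig. 1; Lemma 2.1] [cite: Glazman2015WeightedSAW, Lemma 3.1 (proof, pp. 6–7)] -/
theorem extreme_column_segment (hr : RootedFace D (w.side .W) r) (h : ω.IsB2a) (hz : ω.1 = .N ∨ ω.1 = .S) {σ : Side}
    (hσ : σ = .W ∨ σ = .E) {X₀ Y Y' : ℤ}
    (hY : ∀ j < ω.2.arcs.length, (ω.2.fc j).2 ≤ Y) (hY' : ∀ j < ω.2.arcs.length, Y' ≤ (ω.2.fc j).2)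
    (hforb : ∀ k < ω.2.arcs.length, (ω.2.fc k).1 = X₀ → ω.2.sIn k ≠ σ ∧ ω.2.sOut k ≠ σ)
    (hsv : ∀ i j, i < ω.2.arcs.length → j < ω.2.arcs.length → (ω.2.fc i).1 = X₀ → ω.2.fc i = ω.2.fc j → i = j)
    (hiso : ∀ i < ω.2.arcs.length, (ω.2.fc i).1 = X₀ → arcKind (ω.2.sIn i) (ω.2.sOut i) ≠ .straight →
      (ω.2.fc i).2 = Y ∨ (ω.2.fc i).2 = Y')
    {s : ℕ} (hs : s < ω.2.arcs.length) (hcol : (ω.2.fc s).1 = X₀) (hfirst : ∀ j < s, (ω.2.fc j).1 ≠ X₀)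
    (hins : ω.2.sIn s = .W ∨ ω.2.sIn s = .E) (hout : ω.2.sOut s = .N ∨ ω.2.sOut s = .S) :
    ∃ e, s < e ∧ e + 1 < ω.2.arcs.length ∧ (∀ m < ω.2.arcs.length, (ω.2.fc m).1 = X₀ ↔ (s ≤ m ∧ m ≤ e)) ∧
      (ω.2.sOut e = .W ∨ ω.2.sOut e = .E) ∧ ω.2.sOut e ≠ σ ∧ (ω.2.sIn e = .S ∨ ω.2.sIn e = .N) ∧
      (((ω.2.fc s).2 = Y' ∧ (ω.2.fc e).2 = Y ∧ ω.2.sOut s = .N ∧ ω.2.sIn e = .S ∧ ∀ k, s + k ≤ e → ω.2.fc (s + k) = (X₀, Y' + k)) ∨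
        ((ω.2.fc s).2 = Y ∧ (ω.2.fc e).2 = Y' ∧ ω.2.sOut s = .S ∧ ω.2.sIn e = .N ∧ ∀ k, s + k ≤ e → ω.2.fc (s + k) = (X₀, Y - k))) := by
  classical
  obtain ⟨e, hse, he, hend, hseg, hmono⟩ := column_segment_raw hs hcol hout
  have hnl := segment_not_last hr h hz he hse hfirst hseg hmono
  have he1 : e + 1 < ω.2.arcs.length := by omega
  have hend' : (ω.2.fc (e + 1)).1 ≠ X₀ := by rcases hend with h' | h' <;> [omega; exact h']
  -- the exit side of `e` is horizontal (the successor leaves the column), not `σ`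
  have houtE : ω.2.sOut e = .W ∨ ω.2.sOut e = .E := by
    have key : ¬(ω.2.sOut e = .S ∨ ω.2.sOut e = .N) := fun hSN => hend' (by
      rw [ω.2.fc_succ_col_of_sOut_SN he1 hSN]; exact hseg e hse le_rfl)
    revert key; cases ω.2.sOut e <;> simp
  have houtσ : ω.2.sOut e ≠ σ := (hforb e he (hseg e hse le_rfl)).2
  -- `s < e`: the arc `s` leaves vertically
  have hlt : s < e := by
    rcases Nat.eq_or_lt_of_le hse with hes | hlt
    · exfalso; rw [← hes] at houtE; rcases hout with o | o <;> rcases houtE with o' | o' <;> rw [o] at o' <;> exact absurd o' (by decide)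
    · exact hlt
  -- the entry side of `e` is vertical
  have hine : ω.2.sIn e = .S ∨ ω.2.sIn e = .N := by
    have := ω.2.sIn_SN_of_col_eq (i := e - 1) (by omega) (by
      rw [show e - 1 + 1 = e by omega, hseg e hse le_rfl, hseg (e - 1) (by omega) (by omega)])
    rwa [show e - 1 + 1 = e by omega] at this
  -- so `e` turns: an isolated turn, in an extreme row; so does `s`
  have hke : arcKind (ω.2.sIn e) (ω.2.sOut e) ≠ .straight := by
    rcases hine with i | i <;> rcases houtE with o | o <;> rw [i, o] <;> decide
  have hks : arcKind (ω.2.sIn s) (ω.2.sOut s) ≠ .straight := by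
    rcases hins with i | i <;> rcases hout with o | o <;> rw [i, o] <;> decide
  have hrow_e := hiso e he (hseg e hse le_rfl) hke
  have hrow_s := hiso s hs hcol hks
  -- no re-entry after `e`
  have hnore : ∀ j, e < j → j < ω.2.arcs.length → (ω.2.fc j).1 ≠ X₀ := by
    intro j hej hj hcj
    -- the least re-entry index
    have hex : ∃ j, e < j ∧ j < ω.2.arcs.length ∧ (ω.2.fc j).1 = X₀ := ⟨j, hej, hj, hcj⟩
    obtain ⟨hej₀, hj₀, hcj₀⟩ := Nat.find_spec hex
    set j₀ := Nat.find hex with hj₀def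
    have hminj : ∀ i, e < i → i < j₀ → (ω.2.fc i).1 ≠ X₀ := fun i h1 h2 hc => Nat.find_min hex h2 ⟨h1, by omega, hc⟩
    have hj₀2 : e + 2 ≤ j₀ := by
      by_contra hlt'; have : j₀ = e + 1 := by omega
      exact hend' (by rw [← this]; exact hcj₀)
    -- its predecessor is off the column, so it enters horizontally, through the side opposite to `σ`, and turns
    have hpred : (ω.2.fc (j₀ - 1)).1 ≠ X₀ := hminj (j₀ - 1) (by omega) (by omega)
    have hinj : ω.2.sIn j₀ = .W ∨ ω.2.sIn j₀ = .E := by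
      have key : ¬(ω.2.sIn j₀ = .S ∨ ω.2.sIn j₀ = .N) := fun hSN =>
        hpred (by rw [ω.2.fc_pred_col_of_sIn_SN hj₀ (by omega) hSN]; exact hcj₀)
      revert key; cases ω.2.sIn j₀ <;> simp
    obtain ⟨hinσ, houtσ'⟩ := hforb j₀ hj₀ hcj₀
    have hsd := ω.2.sIn_ne_sOut hj₀
    have houtj : ω.2.sOut j₀ = .N ∨ ω.2.sOut j₀ = .S := by
      revert hinσ houtσ' hsd hinj hσ
      cases σ <;> cases ω.2.sIn j₀ <;> cases ω.2.sOut j₀ <;> simp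
    have hkj : arcKind (ω.2.sIn j₀) (ω.2.sOut j₀) ≠ .straight := by
      rcases hinj with i | i <;> rcases houtj with o | o <;> rw [i, o] <;> decide
    have hrow_j := hiso j₀ hj₀ hcj₀ hkj
    -- three turning plaquettes of column `X₀` in two rows: two coincide
    have hfs : ω.2.fc s ≠ ω.2.fc j₀ := fun e' => by have := hsv s j₀ hs hj₀ hcol e'; omega
    have hfe : ω.2.fc e ≠ ω.2.fc j₀ := fun e' => by have := hsv e j₀ he hj₀ (hseg e hse le_rfl) e'; omega
    have hfse : ω.2.fc s ≠ ω.2.fc e := fun e' => by have := hsv s e hs he hcol e'; omega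
    have hcs := hcol; have hce := hseg e hse le_rfl
    apply hfs
    rcases hrow_s with rs | rs <;> rcases hrow_e with re | re <;> rcases hrow_j with rj | rj
    all_goals first
      | exact absurd (Prod.ext (hcs.trans hce.symm) (rs.trans re.symm)) hfse
      | exact Prod.ext (hcs.trans hcj₀.symm) (rs.trans rj.symm)
      | exact absurd (Prod.ext (hce.trans hcj₀.symm) (re.trans rj.symm)) hfe
  have hiff : ∀ m < ω.2.arcs.length, (ω.2.fc m).1 = X₀ ↔ (s ≤ m ∧ m ≤ e) := by
    intro m hm
    constructor
    · intro hc
      refine ⟨by by_contra hlt'; exact hfirst m (by omega) hc, by by_contra hlt'; exact hnore m (by omega) hm hc⟩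
    · rintro ⟨h1, h2⟩; exact hseg m h1 h2
  refine ⟨e, hlt, he1, hiff, houtE, houtσ, hine, ?_⟩
  -- the rows of `s` and `e` are the two extreme rows, in the order given by the direction
  have hfse : ω.2.fc s ≠ ω.2.fc e := fun e' => by have := hsv s e hs he hcol e'; omega
  rcases hmono with ⟨hNs, -, hfcN⟩ | ⟨hSs, -, hfcS⟩
  · left
    have e2 := hfcN (e - s) (by omega)
    rw [show s + (e - s) = e by omega] at e2
    have hlt_rows : (ω.2.fc s).2 < (ω.2.fc e).2 := by rw [e2]; simp only; omega
    have hrs : (ω.2.fc s).2 = Y' := by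
      rcases hrow_s with rs | rs
      · exfalso; have := hY e he; omega
      · exact rs
    have hre : (ω.2.fc e).2 = Y := by
      rcases hrow_e with re | re
      · exact re
      · exfalso; omega
    have hinS : ω.2.sIn e = .S := by
      rcases hine with i | i
      · exact i
      · exfalso
        have hprev := hfcN (e - 1 - s) (by omega)
        rw [show s + (e - 1 - s) = e - 1 by omega] at hprev
        have := ω.2.fc_pred_eq_of_sIn_N he (by omega) i
        rw [hprev, e2] at this; simp only [Prod.mk.injEq] at this; omega
    exact ⟨hrs, hre, hNs, hinS, fun k hk => by rw [hfcN k hk, hrs]⟩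
  · right
    have e2 := hfcS (e - s) (by omega)
    rw [show s + (e - s) = e by omega] at e2
    have hlt_rows : (ω.2.fc e).2 < (ω.2.fc s).2 := by rw [e2]; simp only; omega
    have hrs : (ω.2.fc s).2 = Y := by
      rcases hrow_s with rs | rs
      · exact rs
      · exfalso; have := hY' e he; omega
    have hre : (ω.2.fc e).2 = Y' := by
      rcases hrow_e with re | re
      · exfalso; omega
      · exact re
    have hinN : ω.2.sIn e = .N := by
      rcases hine with i | i
      · exfalso
        have hprev := hfcS (e - 1 - s) (by omega)
        rw [show s + (e - 1 - s) = e - 1 by omega] at hprev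
        have := ω.2.fc_pred_eq_of_sIn_S he (by omega) i
        rw [hprev, e2] at this; simp only [Prod.mk.injEq] at this; omega
      · exact i
    exact ⟨hrs, hre, hSs, hinN, fun k hk => by rw [hfcS k hk, hrs]⟩

/-- Three isolated-turn plaquettes in one extreme row: two of them coincide (`turn_profile_of_cost_five`: at most two per extreme row).
[cite: GlazmanManolescu2019, §1, Fig. 1 and eq. (1); Lemma 2.1; Remark 2.2] -/
theorem three_in_row {Y₀ : ℤ}
    (hcard : ∀ T : Finset Face,
      (∀ f ∈ T, f ∈ facesL ω.2.mids ∧ (kindsL ω.2.mids f = [.corner] ∨ kindsL ω.2.mids f = [.coCorner])) →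
      (∀ f ∈ T, f.2 = Y₀) → T.card ≤ 2)
    {a b c : Face} (ha : a ∈ facesL ω.2.mids ∧ (kindsL ω.2.mids a = [.corner] ∨ kindsL ω.2.mids a = [.coCorner]))
    (hb : b ∈ facesL ω.2.mids ∧ (kindsL ω.2.mids b = [.corner] ∨ kindsL ω.2.mids b = [.coCorner]))
    (hc : c ∈ facesL ω.2.mids ∧ (kindsL ω.2.mids c = [.corner] ∨ kindsL ω.2.mids c = [.coCorner]))
    (hra : a.2 = Y₀) (hrb : b.2 = Y₀) (hrc : c.2 = Y₀) (hab : a ≠ b) : c = a ∨ c = b := by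
  classical
  by_contra hne
  push Not at hne
  have h3 : ({a, b, c} : Finset Face).card = 3 := by
    rw [Finset.card_insert_of_notMem (by simp [hab, hne.1.symm]), Finset.card_insert_of_notMem (by simp [hne.2.symm]),
      Finset.card_singleton]
  have := hcard {a, b, c} (fun f hf => by
    simp only [Finset.mem_insert, Finset.mem_singleton] at hf
    rcases hf with rfl | rfl | rfl <;> assumption) (fun f hf => by
    simp only [Finset.mem_insert, Finset.mem_singleton] at hf
    rcases hf with rfl | rfl | rfl <;> assumption)
  omega

/-- ★★★ **THE MIDDLE ISOLATED TURN LIES IN AN EXTREME COLUMN.** For a wound class-`B2a` walk of limit cost `5` from the hole root `w.side W`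
(hole `(w.1 − 1, w.2)` absent) with extreme rows `Y' < w.2 < Y`, leftmost column `X ≤ w.1 − 2` and rightmost column `X' ≥ w.1`, every
isolated-turn plaquette lying strictly between the extreme rows lies in column `X` or in column `X'`. (Otherwise both extreme columns are
single straight segments between the frame corners, by the segment lemma, and the top run, one column, the bottom run and the other column
would close a cycle in the arc order.) [cite: GlazmanManolescu2019, §1, Fig. 1 and eq. (1); Lemma 2.1; Remark 2.2]
[cite: Glazman2015WeightedSAW, Lemma 3.1 (proof, pp. 6–7)] -/
theorem middle_turn_in_extreme_column (hh : holeFaceW w ∉ D) (hr : RootedFace D (w.side .W) r) (h : ω.IsB2a)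
    (hA : ω.AJ hr h (toC (midPt (w.side .W))) ≠ 0) (hc : cost (slotOfSide ω.1) ω.2.mids = 5) :
    ∃ Y Y' X X' : ℤ, Y' < w.2 ∧ w.2 < Y ∧ X ≤ w.1 - 2 ∧ w.1 ≤ X' ∧
      (∀ j < ω.2.arcs.length, Y' ≤ (ω.2.fc j).2 ∧ (ω.2.fc j).2 ≤ Y ∧ X ≤ (ω.2.fc j).1 ∧ (ω.2.fc j).1 ≤ X') ∧
      (∃ j < ω.2.arcs.length, (ω.2.fc j).1 = X) ∧ (∃ j < ω.2.arcs.length, (ω.2.fc j).1 = X') ∧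
      ∀ f ∈ facesL ω.2.mids, (kindsL ω.2.mids f = [.corner] ∨ kindsL ω.2.mids f = [.coCorner]) →
        Y' < f.2 → f.2 < Y → f.1 = X ∨ f.1 = X' := by
  classical
  obtain ⟨Y, Y', hY'w, hYw, hY, hY', hprof, -⟩ := turn_profile_of_cost_five hh hr h hA hc
  have hz := end_slanted_of_cost_five hh hr h hA hc
  have hd : slotDeg (slotOfSide ω.1) = 1 := by rcases hz with e | e <;> rw [e] <;> rfl
  obtain ⟨X, hXw, hX, sL, -, hsL, hcolL, hfirstL, hinL, houtL⟩ := exists_left_entry_turn hh hr h hA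
  obtain ⟨X', hX'w, hX', sR, hsR, hcolR, hfirstR, hinR, houtR⟩ := exists_right_entry_turn hh hr h
  refine ⟨Y, Y', X, X', hY'w, hYw, hXw, hX'w, fun j hj => ⟨hY' j hj, hY j hj, hX j hj, hX' j hj⟩, ⟨sL, hsL, hcolL⟩, ⟨sR, hsR, hcolR⟩, ?_⟩
  intro f hf hkf hf1 hf2
  by_contra hne
  push Not at hne
  obtain ⟨hfX, hfX'⟩ := hne
  -- single visits of the extreme rows and columns
  have hsvL : ∀ i j, i < ω.2.arcs.length → j < ω.2.arcs.length → (ω.2.fc i).1 = X → ω.2.fc i = ω.2.fc j → i = j :=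
    fun i j hi hj hcol he => left_single_visit hh hr h hX (by omega) hi hj hcol he
  have hsvR : ∀ i j, i < ω.2.arcs.length → j < ω.2.arcs.length → (ω.2.fc i).1 = X' → ω.2.fc i = ω.2.fc j → i = j :=
    fun i j hi hj hcol he => right_single_visit hh hr h hX' hi hj hcol he
  have hsvT : ∀ i j, i < ω.2.arcs.length → j < ω.2.arcs.length → (ω.2.fc i).2 = Y → ω.2.fc i = ω.2.fc j → i = j :=
    fun i j hi hj hrow he => top_single_visit hh hr h hY hYw hi hj hrow he
  have hsvB : ∀ i j, i < ω.2.arcs.length → j < ω.2.arcs.length → (ω.2.fc i).2 = Y' → ω.2.fc i = ω.2.fc j → i = j :=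
    fun i j hi hj hrow he => bottom_single_visit hh hr h hY' hY'w hi hj hrow he
  -- an isolated turn other than `f` lies in an extreme row
  have hmid : ∀ i < ω.2.arcs.length, (∀ j < ω.2.arcs.length, ω.2.fc j = ω.2.fc i → j = i) →
      arcKind (ω.2.sIn i) (ω.2.sOut i) ≠ .straight → ω.2.fc i ≠ f → (ω.2.fc i).2 = Y ∨ (ω.2.fc i).2 = Y' := by
    intro i hi hsv hk hne'
    obtain ⟨hmem, hkind⟩ := isolated_turn hi hsv hk
    by_contra hrow
    push Not at hrow
    have hlt : Y' < (ω.2.fc i).2 ∧ (ω.2.fc i).2 < Y :=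
      ⟨lt_of_le_of_ne (hY' i hi) (fun e => hrow.2 e.symm), lt_of_le_of_ne (hY i hi) hrow.1⟩
    have := (hprof {f, ω.2.fc i} (fun g hg => by
      simp only [Finset.mem_insert, Finset.mem_singleton] at hg
      rcases hg with rfl | rfl
      · exact ⟨hf, hkf⟩
      · exact ⟨hmem, hkind⟩)).2.2 (fun g hg => by
      simp only [Finset.mem_insert, Finset.mem_singleton] at hg
      rcases hg with rfl | rfl
      · exact ⟨hf1, hf2⟩
      · exact hlt)
    rw [Finset.card_insert_of_notMem (by simpa using hne'.symm), Finset.card_singleton, hd] at this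
    omega
  have hisoL : ∀ i < ω.2.arcs.length, (ω.2.fc i).1 = X → arcKind (ω.2.sIn i) (ω.2.sOut i) ≠ .straight →
      (ω.2.fc i).2 = Y ∨ (ω.2.fc i).2 = Y' :=
    fun i hi hcol hk => hmid i hi (fun j hj he => (hsvL i j hi hj hcol he.symm).symm) hk (fun e => hfX (by rw [← e, hcol]))
  have hisoR : ∀ i < ω.2.arcs.length, (ω.2.fc i).1 = X' → arcKind (ω.2.sIn i) (ω.2.sOut i) ≠ .straight →
      (ω.2.fc i).2 = Y ∨ (ω.2.fc i).2 = Y' :=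
    fun i hi hcol hk => hmid i hi (fun j hj he => (hsvR i j hi hj hcol he.symm).symm) hk (fun e => hfX' (by rw [← e, hcol]))
  -- the two extreme columns are segments between the corners
  obtain ⟨eL, hlL, heL, hiffL, hWE_L, hneWL, -, hsegL⟩ := extreme_column_segment hr h hz (σ := .W) (Or.inl rfl) hY hY'
    (forall_left_ne_W hh hr h hX (by omega)) hsvL hisoL hsL hcolL hfirstL (Or.inr hinL) houtL
  obtain ⟨eR, hlR, heR, hiffR, hWE_R, hneER, -, hsegR⟩ := extreme_column_segment hr h hz (σ := .E) (Or.inr rfl) hY hY'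
    (forall_right_ne_E hh hr h hX') hsvR hisoR hsR hcolR hfirstR (Or.inl hinR) houtR
  have houtEL : ω.2.sOut eL = .E := by
    rcases hWE_L with h' | h'
    · exact absurd h' hneWL
    · exact h'
  have houtWR : ω.2.sOut eR = .W := by
    rcases hWE_R with h' | h'
    · exact h'
    · exact absurd h' hneER
  -- the top and bottom runs
  obtain ⟨Yt, -, hYt, j₀, i₁, hj₀1, hji, hi₁, hrowT, hinT, houtT0, houtT, hinT', hstrT, hmarchT⟩ :=
    top_run_shape hh hr h hA (by omega)
  obtain ⟨Yb, -, hYb, j₀', i₁', hj₀1', hji', hi₁', hrowB, hinB, houtB0, houtB, hinB', hstrB, hmarchB⟩ :=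
    bottom_run_shape hh hr h hA (by omega)
  -- identify the extreme rows with `Y`, `Y'` (the left segment has an arc in each)
  have eYt : Yt = Y := by
    refine le_antisymm ?_ ?_
    · have := hY j₀ (by omega); rw [(hrowT j₀ (by omega)).2 ⟨le_rfl, hji.le⟩] at this; exact this
    · rcases hsegL with ⟨-, hre, -⟩ | ⟨hrs, -⟩
      · have := hYt eL (by omega); rw [hre] at this; exact this
      · have := hYt sL hsL; rw [hrs] at this; exact this
  have eYb : Yb = Y' := by
    refine le_antisymm ?_ ?_
    · rcases hsegL with ⟨hrs, -⟩ | ⟨-, hre, -⟩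
      · have := hYb sL hsL; rw [hrs] at this; exact this
      · have := hYb eL (by omega); rw [hre] at this; exact this
    · have := hY' j₀' (by omega); rw [(hrowB j₀' (by omega)).2 ⟨le_rfl, hji'.le⟩] at this; exact this
  subst eYt; subst eYb
  -- in the top row only `j₀` enters vertically and only `i₁` leaves vertically; bottom likewise
  have honlyT_in : ∀ m < ω.2.arcs.length, (ω.2.fc m).2 = Yt → (ω.2.sIn m = .S ∨ ω.2.sIn m = .N) → m = j₀ := by
    intro m hm hrow hSN
    obtain ⟨h1, h2⟩ := (hrowT m hm).1 hrow
    by_contra hne'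
    rcases lt_or_eq_of_le h2 with hlt' | rfl
    · have hk := hstrT m (by omega) hlt'
      rcases hmarchT with ⟨hWall, -⟩ | ⟨hEall, -⟩
      · rw [hWall m h1 hlt'] at hk; rcases hSN with e | e <;> rw [e] at hk <;> exact absurd hk (by decide)
      · rw [hEall m h1 hlt'] at hk; rcases hSN with e | e <;> rw [e] at hk <;> exact absurd hk (by decide)
    · rcases hinT' with e | e <;> rcases hSN with e' | e' <;> rw [e] at e' <;> exact absurd e' (by decide)
  have honlyT_out : ∀ m < ω.2.arcs.length, (ω.2.fc m).2 = Yt → (ω.2.sOut m = .S ∨ ω.2.sOut m = .N) → m = i₁ := by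
    intro m hm hrow hSN
    obtain ⟨h1, h2⟩ := (hrowT m hm).1 hrow
    by_contra hne'
    have hlt' : m < i₁ := lt_of_le_of_ne h2 hne'
    rcases hmarchT with ⟨hWall, -⟩ | ⟨hEall, -⟩
    · have := hWall m h1 hlt'; rcases hSN with e | e <;> rw [this] at e <;> exact absurd e (by decide)
    · have := hEall m h1 hlt'; rcases hSN with e | e <;> rw [this] at e <;> exact absurd e (by decide)
  have honlyB_in : ∀ m < ω.2.arcs.length, (ω.2.fc m).2 = Yb → (ω.2.sIn m = .S ∨ ω.2.sIn m = .N) → m = j₀' := by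
    intro m hm hrow hSN
    obtain ⟨h1, h2⟩ := (hrowB m hm).1 hrow
    by_contra hne'
    rcases lt_or_eq_of_le h2 with hlt' | rfl
    · have hk := hstrB m (by omega) hlt'
      rcases hmarchB with ⟨hWall, -⟩ | ⟨hEall, -⟩
      · rw [hWall m h1 hlt'] at hk; rcases hSN with e | e <;> rw [e] at hk <;> exact absurd hk (by decide)
      · rw [hEall m h1 hlt'] at hk; rcases hSN with e | e <;> rw [e] at hk <;> exact absurd hk (by decide)
    · rcases hinB' with e | e <;> rcases hSN with e' | e' <;> rw [e] at e' <;> exact absurd e' (by decide)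
  have honlyB_out : ∀ m < ω.2.arcs.length, (ω.2.fc m).2 = Yb → (ω.2.sOut m = .S ∨ ω.2.sOut m = .N) → m = i₁' := by
    intro m hm hrow hSN
    obtain ⟨h1, h2⟩ := (hrowB m hm).1 hrow
    by_contra hne'
    have hlt' : m < i₁' := lt_of_le_of_ne h2 hne'
    rcases hmarchB with ⟨hWall, -⟩ | ⟨hEall, -⟩
    · have := hWall m h1 hlt'; rcases hSN with e | e <;> rw [this] at e <;> exact absurd e (by decide)
    · have := hEall m h1 hlt'; rcases hSN with e | e <;> rw [this] at e <;> exact absurd e (by decide)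
  -- isolated-turn plaquettes: the run ends and the segment ends
  have hisoP : ∀ i < ω.2.arcs.length, (∀ j < ω.2.arcs.length, ω.2.fc j = ω.2.fc i → j = i) →
      arcKind (ω.2.sIn i) (ω.2.sOut i) ≠ .straight →
      ω.2.fc i ∈ facesL ω.2.mids ∧ (kindsL ω.2.mids (ω.2.fc i) = [.corner] ∨ kindsL ω.2.mids (ω.2.fc i) = [.coCorner]) :=
    fun i hi hsv hk => isolated_turn hi hsv hk
  have hPj₀ := hisoP j₀ (by omega) (fun j hj he => (hsvT j₀ j (by omega) hj ((hrowT j₀ (by omega)).2 ⟨le_rfl, hji.le⟩) he.symm).symm)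
    (by rw [hinT]; rcases houtT0 with e | e <;> rw [e] <;> decide)
  have hPi₁ := hisoP i₁ hi₁ (fun j hj he => (hsvT i₁ j hi₁ hj ((hrowT i₁ hi₁).2 ⟨hji.le, le_rfl⟩) he.symm).symm)
    (by rw [houtT]; rcases hinT' with e | e <;> rw [e] <;> decide)
  have hPj₀' := hisoP j₀' (by omega) (fun j hj he => (hsvB j₀' j (by omega) hj ((hrowB j₀' (by omega)).2 ⟨le_rfl, hji'.le⟩) he.symm).symm)
    (by rw [hinB]; rcases houtB0 with e | e <;> rw [e] <;> decide)
  have hPi₁' := hisoP i₁' hi₁' (fun j hj he => (hsvB i₁' j hi₁' hj ((hrowB i₁' hi₁').2 ⟨hji'.le, le_rfl⟩) he.symm).symm)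
    (by rw [houtB]; rcases hinB' with e | e <;> rw [e] <;> decide)
  have hj₀i₁ : ω.2.fc j₀ ≠ ω.2.fc i₁ := fun e =>
    absurd (hsvT j₀ i₁ (by omega) hi₁ ((hrowT j₀ (by omega)).2 ⟨le_rfl, hji.le⟩) e) (by omega)
  have hj₀i₁' : ω.2.fc j₀' ≠ ω.2.fc i₁' := fun e =>
    absurd (hsvB j₀' i₁' (by omega) hi₁' ((hrowB j₀' (by omega)).2 ⟨le_rfl, hji'.le⟩) e) (by omega)
  have hcardT := fun (T : Finset Face) hT => (hprof T hT).1
  have hcardB := fun (T : Finset Face) hT => (hprof T hT).2.1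
  have hXX : X < X' := by omega
  -- entry sides of the run ends from the marching direction
  have hinI₁_of_E : (∀ m, j₀ ≤ m → m < i₁ → ω.2.sOut m = .E) → ω.2.sIn i₁ = .W := fun hEall => by
    have := (ω.2.fc_succ_eq_of_sOut_E (show i₁ - 1 + 1 < ω.2.arcs.length by omega) (hEall (i₁ - 1) (by omega) (by omega))).2
    rwa [show i₁ - 1 + 1 = i₁ by omega] at this
  have hinI₁_of_W : (∀ m, j₀ ≤ m → m < i₁ → ω.2.sOut m = .W) → ω.2.sIn i₁ = .E := fun hWall => by
    have := (ω.2.fc_succ_eq_of_sOut_W (show i₁ - 1 + 1 < ω.2.arcs.length by omega) (hWall (i₁ - 1) (by omega) (by omega))).2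
    rwa [show i₁ - 1 + 1 = i₁ by omega] at this
  have hinI₁'_of_E : (∀ m, j₀' ≤ m → m < i₁' → ω.2.sOut m = .E) → ω.2.sIn i₁' = .W := fun hEall => by
    have := (ω.2.fc_succ_eq_of_sOut_E (show i₁' - 1 + 1 < ω.2.arcs.length by omega) (hEall (i₁' - 1) (by omega) (by omega))).2
    rwa [show i₁' - 1 + 1 = i₁' by omega] at this
  have hinI₁'_of_W : (∀ m, j₀' ≤ m → m < i₁' → ω.2.sOut m = .W) → ω.2.sIn i₁' = .E := fun hWall => by
    have := (ω.2.fc_succ_eq_of_sOut_W (show i₁' - 1 + 1 < ω.2.arcs.length by omega) (hWall (i₁' - 1) (by omega) (by omega))).2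
    rwa [show i₁' - 1 + 1 = i₁' by omega] at this
  -- isolated-turn plaquettes at the segment ends
  have hsvsL : ∀ i, i < ω.2.arcs.length → (ω.2.fc i).1 = X → ∀ j < ω.2.arcs.length, ω.2.fc j = ω.2.fc i → j = i :=
    fun i hi hcol j hj he => (hsvL i j hi hj hcol he.symm).symm
  have hsvsR : ∀ i, i < ω.2.arcs.length → (ω.2.fc i).1 = X' → ∀ j < ω.2.arcs.length, ω.2.fc j = ω.2.fc i → j = i :=
    fun i hi hcol j hj he => (hsvR i j hi hj hcol he.symm).symm
  have hcolEL : (ω.2.fc eL).1 = X := (hiffL eL (by omega)).2 ⟨hlL.le, le_rfl⟩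
  have hcolER : (ω.2.fc eR).1 = X' := (hiffR eR (by omega)).2 ⟨hlR.le, le_rfl⟩
  have hPsL := hisoP sL hsL (hsvsL sL hsL hcolL) (by rw [hinL]; rcases houtL with e | e <;> rw [e] <;> decide)
  have hPsR := hisoP sR hsR (hsvsR sR hsR hcolR) (by rw [hinR]; rcases houtR with e | e <;> rw [e] <;> decide)
  rcases hsegL with ⟨hrsL, hreL, hNsL, hSeL, -⟩ | ⟨hrsL, hreL, hSsL, hNeL, -⟩
  · -- LEFT SEGMENT UPWARDS: `sL` at `(X, Yb)`, `eL` at `(X, Yt)` entering `S`, leaving `E`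
    have hPeL := hisoP eL (by omega) (hsvsL eL (by omega) hcolEL) (by rw [hSeL, houtEL]; decide)
    have hj₀ : eL = j₀ := honlyT_in eL (by omega) hreL (Or.inl hSeL)
    -- the top run marches east from column `X`
    rcases hmarchT with ⟨hWall, hlenT⟩ | ⟨hEall, hlenT⟩
    · exfalso; have := hX i₁ hi₁; rw [← hj₀, hcolEL] at hlenT; omega
    have hinI₁ := hinI₁_of_E hEall
    -- the right segment's top-row end is `fc i₁`, entered from `W`: it is `sR`, and the right segment goes down
    rcases hsegR with ⟨hrsR, hreR, hNsR, hSeR, -⟩ | ⟨hrsR, hreR, hSsR, hNeR, -⟩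
    · exfalso
      have hPeR := hisoP eR (by omega) (hsvsR eR (by omega) hcolER) (by rw [hSeR, houtWR]; decide)
      rcases three_in_row hcardT hPj₀ hPi₁ hPeR ((hrowT j₀ (by omega)).2 ⟨le_rfl, hji.le⟩) ((hrowT i₁ hi₁).2 ⟨hji.le, le_rfl⟩)
        hreR hj₀i₁ with e | e
      · have := congrArg Prod.fst e; rw [hcolER, ← hj₀, hcolEL] at this; omega
      · have := hsvT eR i₁ (by omega) hi₁ hreR e; rw [this, hinI₁] at hSeR; exact absurd hSeR (by decide)
    rcases three_in_row hcardT hPj₀ hPi₁ hPsR ((hrowT j₀ (by omega)).2 ⟨le_rfl, hji.le⟩) ((hrowT i₁ hi₁).2 ⟨hji.le, le_rfl⟩)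
      hrsR hj₀i₁ with e | e
    · exfalso; have := congrArg Prod.fst e; rw [hcolR, ← hj₀, hcolEL] at this; omega
    have hsRi₁ : sR = i₁ := hsvT sR i₁ hsR hi₁ hrsR e
    -- the right segment ends at `(X', Yb)` entering `N`, leaving `W`: the bottom run's entry
    have hj₀' : eR = j₀' := honlyB_in eR (by omega) hreR (Or.inr hNeR)
    -- the bottom run marches west from column `X'`
    rcases hmarchB with ⟨hWallB, hlenB⟩ | ⟨hEallB, hlenB⟩
    · have hinI₁' := hinI₁'_of_W hWallB
      -- its west end is the left segment's start `sL`
      rcases three_in_row hcardB hPj₀' hPi₁' hPsL ((hrowB j₀' (by omega)).2 ⟨le_rfl, hji'.le⟩)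
          ((hrowB i₁' hi₁').2 ⟨hji'.le, le_rfl⟩) hrsL hj₀i₁' with e' | e'
      · exfalso; have := congrArg Prod.fst e'; rw [hcolL, ← hj₀', hcolER] at this; omega
      · have hsLi₁' : sL = i₁' := hsvB sL i₁' hsL hi₁' hrsL e'
        omega
    · exfalso; have := hX' i₁' hi₁'; rw [← hj₀', hcolER] at hlenB; omega
  · -- LEFT SEGMENT DOWNWARDS: `sL` at `(X, Yt)` entering `E`, leaving `S`; `eL` at `(X, Yb)` entering `N`, leaving `E`
    have hPeL := hisoP eL (by omega) (hsvsL eL (by omega) hcolEL) (by rw [hNeL, houtEL]; decide)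
    have hi₁sL : sL = i₁ := honlyT_out sL hsL hrsL (Or.inl hSsL)
    -- the top run marches west, ending at column `X`
    rcases hmarchT with ⟨hWall, hlenT⟩ | ⟨hEall, hlenT⟩
    swap
    · exfalso; have := hX j₀ (by omega); rw [← hi₁sL, hcolL] at hlenT; omega
    -- its east end `j₀` (entering from `S`) is the right segment's top-row end: `eR`, and the right segment goes up
    rcases hsegR with ⟨hrsR, hreR, hNsR, hSeR, -⟩ | ⟨hrsR, hreR, hSsR, hNeR, -⟩
    swap
    · exfalso
      rcases three_in_row hcardT hPj₀ hPi₁ hPsR ((hrowT j₀ (by omega)).2 ⟨le_rfl, hji.le⟩) ((hrowT i₁ hi₁).2 ⟨hji.le, le_rfl⟩)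
          hrsR hj₀i₁ with e | e
      · have := hsvT sR j₀ hsR (by omega) hrsR e; rw [this, hinT] at hinR; exact absurd hinR (by decide)
      · have := congrArg Prod.fst e; rw [hcolR, ← hi₁sL, hcolL] at this; omega
    have hPeR := hisoP eR (by omega) (hsvsR eR (by omega) hcolER) (by rw [hSeR, houtWR]; decide)
    rcases three_in_row hcardT hPj₀ hPi₁ hPeR ((hrowT j₀ (by omega)).2 ⟨le_rfl, hji.le⟩) ((hrowT i₁ hi₁).2 ⟨hji.le, le_rfl⟩)
        hreR hj₀i₁ with e | e
    swap
    · exfalso; have := congrArg Prod.fst e; rw [hcolER, ← hi₁sL, hcolL] at this; omega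
    have heRj₀ : eR = j₀ := hsvT eR j₀ (by omega) (by omega) hreR e
    -- the left segment's end `eL` at `(X, Yb)` entering `N` is the bottom run's entry
    have hj₀' : eL = j₀' := honlyB_in eL (by omega) hreL (Or.inr hNeL)
    -- the bottom run marches east from column `X`; its east end (entering `W`) is the right segment's start `sR`
    rcases hmarchB with ⟨hWallB, hlenB⟩ | ⟨hEallB, hlenB⟩
    · exfalso; have := hX i₁' hi₁'; rw [← hj₀', hcolEL] at hlenB; omega
    · have hinI₁' := hinI₁'_of_E hEallB
      rcases three_in_row hcardB hPj₀' hPi₁' hPsR ((hrowB j₀' (by omega)).2 ⟨le_rfl, hji'.le⟩)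
          ((hrowB i₁' hi₁').2 ⟨hji'.le, le_rfl⟩) hrsR hj₀i₁' with e' | e'
      · exfalso; have := congrArg Prod.fst e'; rw [hcolR, ← hj₀', hcolEL] at this; omega
      · have hsRi₁' : sR = i₁' := hsvB sR i₁' hsR hi₁' hrsR e'
        omega

end ΩG

end Literature.Probability.RandomPlanarGeometry.SAW.YangBaxter
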